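import Literature.NumberTheory.Sieve.RoughOmegaCellsStep
import Literature.NumberTheory.Sieve.RoughOmegaCellsDensityWeights
import HarnessLib

/-!
# Ω-cells of the rough integers: Alladi's asymptotic with a rate

Topic `Literature/NumberTheory/Sieve`. Everything here is PROVED. For a density family
`F : ℕ → ℝ → ℝ` with `F_0 ≡ 1`, `F_{i+1}(v) = ∫_1^{v−1} F_i(s) ds/s` (`v ≥ 2`), `F_{i+1} = 0` on
`v ≤ i+2`, `F_i` continuous on `[1, ∞)` and `F_{i+1}'(s) = F_i(s−1)/(s−1)` (`s > 2`) — the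
Alladi–Buchstab cell densities `I_{i+1}(u) = F_i(u)` (`I_1 = 1`, `I_2(u) = log(u−1)`, …,
`Σ_i I_i(u) = u ω(u)`) are the intended (and, by the recursion, the only) instance — and given the prime
number theorem in the `(X, Y)`-format `#{⌈Y⌉ ≤ p ≤ ⌊X⌋} = X/log X − Y/log Y + O(X/log² Y)`
(`Literature.NumberTheory.LFunctions.exists_abs_card_primes_Icc_ceil_floor_sub_le`):

* `abs_cell_sub_main_step` — the self-contained inductive step `k → k + 1` for the `Ω = i+2` cells on
  `e² ≤ y ≤ x`, `k log y < log x ≤ (k+1) log y` (parameters `z = x^{1/k}`, `a = ⌈y⌉ − 1`, `b = ⌈z⌉ − 1`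
  as in `RoughNumbersBuchstabStep.lean`);
* `exists_abs_cell_sub_main_le` — **Alladi's theorem with a rate**: for every `i, k` there is `C` with
  `|#{b ≤ X : P⁻(b) ≥ Y, Ω(b) = i+1} − (X F_i(u)/log X − [i = 0] Y/log Y)| ≤ C X/log² Y` for all
  `2 ≤ Y ≤ X ≤ Y^k` (induction on `i`; for `i ≥ 1` induction on `k` from the trivial range `k ≤ i+1`,
  which keeps every weight window inside the `C¹` range of the densities).

Alladi (1982) proves the asymptotic `Φ_k(x, y) ∼ I_k(u) x/log x` for the number of `y`-rough `n ≤ x`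
with `k` prime factors, `u = log x/log y` bounded, with these densities; the explicit `O(x/log² y)`
rate here is the one of the tree's `Φ(x, y)` theorem (Lichtman's Lemma 6.1, Harman App. A.2).

## References

* K. Alladi, *The distribution of ν(n) in the sieve of Eratosthenes*, Quart. J. Math. Oxford (2) 33
  (1982), 129–148. [Alladi1982]
* G. Tenenbaum, *Introduction to analytic and probabilistic number theory*, Ch. III.6. [Tenenbaum2015]
* J. D. Lichtman, arXiv:2109.02851, Lemma 6.1. [Lichtman2025LinearSieve]
-/

open Finset Real MeasureTheory Set
open scoped Chebyshev

noncomputable section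

namespace Literature.NumberTheory.Sieve

/-! ### The self-contained inductive step -/

/-- **The inductive step for the Ω-cells (main case).** Assume `P_{i+1}(k, C)` and `P_i(k, C')`
(`k ≥ 2`), the regularity of the weight `σ = F_i(s)/s` on `[k−1, 2k+1]` and the recursion
`∫_{k−1}^{v−1} σ = F_{i+1}(v) − F_{i+1}(k)` (`k ≤ v ≤ k+1`). Then for `e² ≤ y ≤ x` with
`k log y < log x ≤ (k + 1) log y` the `Ω = i+2` cell satisfies `P_{i+1}` at `(x, y)` with an explicit
constant (Buchstab's identity at `z = x^{1/k}`; Harman, Appendix A.2). [cite: Alladi1982, §2] -/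
theorem abs_cell_sub_main_step {F : ℕ → ℝ → ℝ} {σ' : ℝ → ℝ} {i k : ℕ} (hk : 2 ≤ k)
    {C C' C₀ B B' : ℝ} (hC : 0 ≤ C) (hC' : 0 ≤ C') (hC₀ : 0 ≤ C₀) (hB : 0 ≤ B) (hB' : 0 ≤ B')
    (hE : ∀ t : ℝ, 2 ≤ t → |θ t - t| ≤ C₀ * t / Real.log t ^ 2)
    (hPsame : ∀ X Y : ℝ, 2 ≤ Y → Y ≤ X → Real.log X ≤ k * Real.log Y →
      |((((roughIcc ⌈Y⌉₊ ⌊X⌋₊).filter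
          (fun b => ArithmeticFunction.cardFactors b = i + 1 + 1)).card : ℕ) : ℝ) -
        X * F (i + 1) (Real.log X / Real.log Y) / Real.log X| ≤ C * X / Real.log Y ^ 2)
    (hPprev : ∀ X Y : ℝ, 2 ≤ Y → Y ≤ X → Real.log X ≤ k * Real.log Y →
      |((((roughIcc ⌈Y⌉₊ ⌊X⌋₊).filter
          (fun b => ArithmeticFunction.cardFactors b = i + 1)).card : ℕ) : ℝ) -
        (X * F i (Real.log X / Real.log Y) / Real.log X - if i = 0 then Y / Real.log Y else 0)| ≤
        C' * X / Real.log Y ^ 2)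
    (hσc : ContinuousOn (fun s => F i s / s) (Set.Icc ((k : ℝ) - 1) (2 * k + 1)))
    (hσ : ∀ s : ℝ, (k : ℝ) - 1 < s → s ≤ 2 * k + 1 → HasDerivAt (fun s => F i s / s) (σ' s) s)
    (hσ'c : ContinuousOn σ' (Set.Ioc ((k : ℝ) - 1) (2 * k + 1)))
    (hσb : ∀ s : ℝ, (k : ℝ) - 1 ≤ s → s ≤ 2 * k + 1 → |F i s / s| ≤ B)
    (hσ'b : ∀ s : ℝ, (k : ℝ) - 1 < s → s ≤ 2 * k + 1 → |σ' s| ≤ B')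
    (hrec : ∀ v : ℝ, (k : ℝ) ≤ v → v ≤ k + 1 →
      ∫ s in ((k : ℝ) - 1)..(v - 1), F i s / s = F (i + 1) v - F (i + 1) k)
    {x y : ℝ} (hy : Real.exp 2 ≤ y) (hyx : y ≤ x) (hkxy : k * Real.log y < Real.log x)
    (hxy : Real.log x ≤ (k + 1) * Real.log y) :
    |((((roughIcc ⌈y⌉₊ ⌊x⌋₊).filter
        (fun b => ArithmeticFunction.cardFactors b = i + 1 + 1)).card : ℕ) : ℝ) -
      x * F (i + 1) (Real.log x / Real.log y) / Real.log x| ≤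
      (C + C' * (3 + 8 * C₀) + 4 * ((2 + 3 * (2 * (k + 1) * B' + 3 * B)) * C₀ * (B + 1) + 2 * B) +
        4 * (1 + 5 * C₀)) * x / Real.log y ^ 2 := by
  -- numerics about `y`, `x`
  have hk2 : (2 : ℝ) ≤ k := by exact_mod_cast hk
  have hk0 : (0 : ℝ) < k := by linarith
  have he1 : (2 : ℝ) ≤ Real.exp 1 := by have := Real.add_one_le_exp (1 : ℝ); linarith
  have he2 : Real.exp 1 ≤ Real.exp 2 - 1 := by
    have h2 : Real.exp 2 = Real.exp 1 * Real.exp 1 := by rw [← Real.exp_add]; norm_num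
    nlinarith
  have hy0 : 0 < y := (Real.exp_pos 2).trans_le hy
  have hy3 : 3 ≤ y := le_trans (by have := Real.add_one_le_exp (2 : ℝ); linarith) hy
  have hy1 : 1 < y := by linarith
  have hly2 : 2 ≤ Real.log y := by rw [Real.le_log_iff_exp_le hy0]; exact hy
  have hly : 0 < Real.log y := by linarith
  have hLx : 0 < Real.log x := by
    have : (k : ℝ) * Real.log y ≥ 2 * 2 := mul_le_mul hk2 hly2 (by norm_num) hk0.le
    linarith
  have hx1 : 1 < x := by linarith
  have hx0 : 0 < x := by linarith
  have hyu : (k : ℝ) ≤ Real.log x / Real.log y := by rw [le_div_iff₀ hly]; exact hkxy.le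
  have hu1 : Real.log x / Real.log y ≤ k + 1 := by rw [div_le_iff₀ hly]; exact hxy
  -- `z = x^{1/k}`
  set z : ℝ := Real.exp (Real.log x / k) with hz_def
  have hz0 : 0 < z := Real.exp_pos _
  have hz_log : Real.log z = Real.log x / k := Real.log_exp _
  have hyz : y < z := by
    have h : Real.log y < Real.log x / k := by rw [lt_div_iff₀ hk0]; linarith
    calc y = Real.exp (Real.log y) := (Real.exp_log hy0).symm
      _ < z := Real.exp_lt_exp.mpr h
  have hzz : z * z ≤ x := by
    have h : Real.log x / k + Real.log x / k ≤ Real.log x := by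
      rw [← two_mul, ← mul_div_assoc, div_le_iff₀ hk0]
      have : Real.log x * 2 ≤ Real.log x * k := mul_le_mul_of_nonneg_left hk2 hLx.le
      linarith
    calc z * z = Real.exp (Real.log x / k + Real.log x / k) := by rw [Real.exp_add]
      _ ≤ Real.exp (Real.log x) := Real.exp_le_exp.mpr h
      _ = x := Real.exp_log hx0
  have hz1 : 1 ≤ z := by linarith
  have hzx : z ≤ x := le_trans (le_mul_of_one_le_left hz0.le hz1) hzz
  have hz2 : (2 : ℝ) ≤ z := by linarith
  have hlz : Real.log y < Real.log z := Real.log_lt_log hy0 hyz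
  -- `N = ⌈y⌉`, `M = ⌈z⌉`, `a = N − 1`, `b = M − 1`
  set N := ⌈y⌉₊ with hN
  set M := ⌈z⌉₊ with hM
  have hN1 : 0 < N := Nat.ceil_pos.mpr hy0
  have hM1 : 0 < M := Nat.ceil_pos.mpr hz0
  have hNM : N ≤ M := Nat.ceil_le_ceil hyz.le
  set a : ℝ := ((N - 1 : ℕ) : ℝ) with ha_def
  set b : ℝ := ((M - 1 : ℕ) : ℝ) with hb_def
  have haN : a = (N : ℝ) - 1 := by rw [ha_def, Nat.cast_sub hN1, Nat.cast_one]
  have hbM : b = (M : ℝ) - 1 := by rw [hb_def, Nat.cast_sub hM1, Nat.cast_one]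
  have hyN : y ≤ N := Nat.le_ceil y
  have hNy : (N : ℝ) < y + 1 := Nat.ceil_lt_add_one hy0.le
  have hzM : z ≤ M := Nat.le_ceil z
  have hMz : (M : ℝ) < z + 1 := Nat.ceil_lt_add_one hz0.le
  have hay : a ≤ y := by rw [haN]; linarith
  have hya : y ≤ a + 1 := by rw [haN]; linarith
  have hbz : b < z := by rw [hbM]; linarith
  have hzb : z ≤ b + 1 := by rw [hbM]; linarith
  have hab : a ≤ b := by
    rw [haN, hbM]
    have : (N : ℝ) ≤ M := by exact_mod_cast hNM
    linarith
  have hea : Real.exp 1 ≤ a := by linarith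
  have ha0 : 0 < a := (Real.exp_pos 1).trans_le hea
  have hla : 1 ≤ Real.log a := by rw [Real.le_log_iff_exp_le ha0]; exact hea
  have hasq : y ≤ a ^ 2 := by
    have h1 : y - 1 ≤ a := by linarith
    have h2 : (y - 1) ^ 2 ≤ a ^ 2 := pow_le_pow_left₀ (by linarith) h1 2
    have h3 : y ≤ (y - 1) ^ 2 := by nlinarith
    exact h3.trans h2
  have hlya : Real.log y ≤ 2 * Real.log a := by
    calc Real.log y ≤ Real.log (a ^ 2) := Real.log_le_log hy0 hasq
      _ = 2 * Real.log a := by rw [Real.log_pow]; norm_num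
  have hxa : Real.log x ≤ 2 * (k + 1) * Real.log a := by
    calc Real.log x ≤ (k + 1) * Real.log y := hxy
      _ ≤ (k + 1) * (2 * Real.log a) := by gcongr
      _ = 2 * (k + 1) * Real.log a := by ring
  have hb0 : 0 < b := ha0.trans_le hab
  have hlb : Real.log b ≤ 3 * Real.log a := by
    have h1 : (k : ℝ) * Real.log b < Real.log x := by
      calc (k : ℝ) * Real.log b < k * Real.log z := by gcongr
        _ = Real.log x := by rw [hz_log]; field_simp
    have hkl : 2 * Real.log a ≤ (k : ℝ) * Real.log a := mul_le_mul_of_nonneg_right hk2 (by linarith)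
    have h2 : Real.log x ≤ (k : ℝ) * (3 * Real.log a) := by
      calc Real.log x ≤ 2 * (k + 1) * Real.log a := hxa
        _ ≤ (k : ℝ) * (3 * Real.log a) := by linarith
    exact (lt_of_mul_lt_mul_left (h1.trans_le h2) hk0.le).le
  -- the index set of primes `y ≤ p < z`
  have hfloor_a : ⌊a⌋₊ = N - 1 := by rw [ha_def, Nat.floor_natCast]
  have hfloor_b : ⌊b⌋₊ = M - 1 := by rw [hb_def, Nat.floor_natCast]
  have hS : (Finset.Ico N M).filter Nat.Prime = (Finset.Ioc ⌊a⌋₊ ⌊b⌋₊).filter Nat.Prime := by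
    rw [hfloor_a, hfloor_b]
    congr 1
    ext p
    simp only [Finset.mem_Ico, Finset.mem_Ioc]
    omega
  have hpS : ∀ p ∈ (Finset.Ioc ⌊a⌋₊ ⌊b⌋₊).filter Nat.Prime, y ≤ (p : ℝ) ∧ (p : ℝ) ≤ b := by
    intro p hp
    rw [Finset.mem_filter, Finset.mem_Ioc, hfloor_a, hfloor_b] at hp
    obtain ⟨⟨h1, h2⟩, -⟩ := hp
    refine ⟨?_, ?_⟩
    · have : N ≤ p := by omega
      calc y ≤ N := hyN
        _ ≤ p := by exact_mod_cast this
    · rw [hbM]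
      have : p + 1 ≤ M := by omega
      have : (p : ℝ) + 1 ≤ M := by exact_mod_cast this
      linarith
  have hpy : ∀ p ∈ (Finset.Ioc ⌊a⌋₊ ⌊b⌋₊).filter Nat.Prime, y ≤ (p : ℝ) := fun p hp => (hpS p hp).1
  have hpx : ∀ p ∈ (Finset.Ioc ⌊a⌋₊ ⌊b⌋₊).filter Nat.Prime, (p : ℝ) ^ 2 ≤ x := fun p hp => by
    obtain ⟨-, h2⟩ := hpS p hp
    have hpz : (p : ℝ) ≤ z := h2.trans hbz.le
    have hp0 : (0 : ℝ) ≤ p := Nat.cast_nonneg p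
    rw [sq]
    exact le_trans (mul_le_mul hpz hpz hp0 hz0.le) hzz
  have hxp : ∀ p ∈ (Finset.Ioc ⌊a⌋₊ ⌊b⌋₊).filter Nat.Prime, Real.log x ≤ (k + 1) * Real.log p :=
    fun p hp => by
    obtain ⟨h1, -⟩ := hpS p hp
    calc Real.log x ≤ (k + 1) * Real.log y := hxy
      _ ≤ (k + 1) * Real.log p := by gcongr
  exact abs_cell_sub_main_step_of hk hC hC' hC₀ hB hB' hE hPsame hPprev hN.symm hM.symm hNM hS hx0
    hx1.le hy1 hly hz0 hz2 hzx hzz hyz.le hlz hz_log hyu hea hay hya hab hbz hzb hb0 hlb hlya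
    hxa hpy hpx hxp hσc hσ hσ'c hσb hσ'b (hrec _ hyu hu1)

/-! ### The induction: Alladi's asymptotic for every `Ω`-cell, with a rate -/

/-- **Alladi's asymptotic for the Ω-cells of the rough integers, with a rate** (abstract form). Let
`F_0 ≡ 1`, `F_{i+1}(v) = ∫_1^{v−1} F_i(s) ds/s` (`v ≥ 2`), `F_{i+1} = 0` on `v ≤ i+2`, every `F_i`
continuous on `[1, ∞)` and `F_{i+1}'(s) = F_i(s−1)/(s−1)` for `s > 2` (the Alladi–Buchstab cell
densities `I_{i+1} = F_i`), and assume the prime number theorem in the form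
`#{⌈Y⌉ ≤ p ≤ ⌊X⌋} = X/log X − Y/log Y + O(X/log² Y)`. Then for every `i, k` there is `C` with
`|#{b ≤ X : P⁻(b) ≥ Y, Ω(b) = i+1} − (X F_i(u)/log X − [i = 0] Y/log Y)| ≤ C X/log² Y`
for all `2 ≤ Y ≤ X ≤ Y^k`, `u = log X/log Y` (induction on `i`, and on `k` from the trivial range
`k ≤ i + 1`, over the Ω-refined Buchstab identity). [cite: Alladi1982, Theorem 1] -/
theorem exists_abs_cell_sub_main_le {F : ℕ → ℝ → ℝ} (hF0 : ∀ s, F 0 s = 1)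
    (hFc : ∀ i, ContinuousOn (F i) (Set.Ici 1))
    (hFz : ∀ (i : ℕ) (v : ℝ), v ≤ (i : ℝ) + 2 → F (i + 1) v = 0)
    (hFrec : ∀ (i : ℕ) (v : ℝ), 2 ≤ v → F (i + 1) v = ∫ s in (1 : ℝ)..(v - 1), F i s / s)
    (hFd : ∀ (i : ℕ) (s : ℝ), 2 < s → HasDerivAt (F (i + 1)) (F i (s - 1) / (s - 1)) s)
    (hprime : ∀ k : ℕ, ∃ C : ℝ, 0 ≤ C ∧ ∀ X Y : ℝ, 2 ≤ Y → Y ≤ X → Real.log X ≤ k * Real.log Y →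
      |((((Finset.Icc ⌈Y⌉₊ ⌊X⌋₊).filter Nat.Prime).card : ℕ) : ℝ) - (X / Real.log X - Y / Real.log Y)| ≤
        C * X / Real.log Y ^ 2) :
    ∀ i k : ℕ, ∃ C : ℝ, 0 ≤ C ∧ ∀ X Y : ℝ, 2 ≤ Y → Y ≤ X → Real.log X ≤ k * Real.log Y →
      |((((roughIcc ⌈Y⌉₊ ⌊X⌋₊).filter
          (fun b => ArithmeticFunction.cardFactors b = i + 1)).card : ℕ) : ℝ) -
        (X * F i (Real.log X / Real.log Y) / Real.log X - if i = 0 then Y / Real.log Y else 0)| ≤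
        C * X / Real.log Y ^ 2 := by
  obtain ⟨C₀, hC₀, hE⟩ := Literature.NumberTheory.LFunctions.exists_abs_theta_sub_self_le_div_log_sq
  intro i
  induction i with
  | zero =>
    intro k
    obtain ⟨C, hC, hP⟩ := hprime k
    refine ⟨C, hC, fun X Y hY hYX hXY => ?_⟩
    rw [show (0 : ℕ) + 1 = 1 from rfl, card_roughIcc_filter_cardFactors_one, if_pos rfl, hF0, mul_one]
    exact hP X Y hY hYX hXY
  | succ j ih =>
    -- level `j + 1`: the `Ω = j + 2` cells, density `F_{j+1}`; the secondary term is absent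
    suffices hQ : ∀ k : ℕ, ∃ C : ℝ, 0 ≤ C ∧ ∀ X Y : ℝ, 2 ≤ Y → Y ≤ X →
        Real.log X ≤ k * Real.log Y →
        |((((roughIcc ⌈Y⌉₊ ⌊X⌋₊).filter
            (fun b => ArithmeticFunction.cardFactors b = j + 1 + 1)).card : ℕ) : ℝ) -
          X * F (j + 1) (Real.log X / Real.log Y) / Real.log X| ≤ C * X / Real.log Y ^ 2 by
      intro k
      obtain ⟨C, hC, h⟩ := hQ k
      refine ⟨C, hC, fun X Y hY hYX hXY => ?_⟩
      rw [if_neg (Nat.succ_ne_zero j), sub_zero]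
      exact h X Y hY hYX hXY
    -- the trivial range `k ≤ j + 2`
    have htriv : ∀ k : ℕ, k ≤ j + 2 → ∃ C : ℝ, 0 ≤ C ∧ ∀ X Y : ℝ, 2 ≤ Y → Y ≤ X →
        Real.log X ≤ k * Real.log Y →
        |((((roughIcc ⌈Y⌉₊ ⌊X⌋₊).filter
            (fun b => ArithmeticFunction.cardFactors b = j + 1 + 1)).card : ℕ) : ℝ) -
          X * F (j + 1) (Real.log X / Real.log Y) / Real.log X| ≤ C * X / Real.log Y ^ 2 :=
      fun k hk => ⟨4, by norm_num, fun X Y hY hYX hXY => abs_cell_sub_main_le_of_le hFz hk hY hYX hXY⟩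
    -- induction on `k` from `k = j + 2`
    suffices h : ∀ n : ℕ, ∃ C : ℝ, 0 ≤ C ∧ ∀ X Y : ℝ, 2 ≤ Y → Y ≤ X →
        Real.log X ≤ ((j + 2 + n : ℕ) : ℝ) * Real.log Y →
        |((((roughIcc ⌈Y⌉₊ ⌊X⌋₊).filter
            (fun b => ArithmeticFunction.cardFactors b = j + 1 + 1)).card : ℕ) : ℝ) -
          X * F (j + 1) (Real.log X / Real.log Y) / Real.log X| ≤ C * X / Real.log Y ^ 2 by
      intro k
      rcases le_or_gt k (j + 2) with hk | hk
      · exact htriv k hk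
      · obtain ⟨n, rfl⟩ : ∃ n, k = j + 2 + n := ⟨k - (j + 2), by omega⟩
        exact h n
    intro n
    induction n with
    | zero => simpa using htriv (j + 2) le_rfl
    | succ n ihn =>
      obtain ⟨C, hC, hPk⟩ := ihn
      obtain ⟨C', hC', hPk'⟩ := ih (j + 2 + n)
      set k : ℕ := j + 2 + n with hk_def
      have hk2 : 2 ≤ k := by omega
      have hk2' : (2 : ℝ) ≤ k := by exact_mod_cast hk2
      obtain ⟨B, B', σ', hB, hB', hσc, hσ, hσ'c, hσb, hσ'b⟩ :=
        density_weight_regular hF0 hFc hFd j k (by omega)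
      obtain ⟨B₂, hB₂0, hB₂⟩ := exists_bound_abs_density hFc (j + 1) ((k : ℝ) + 1)
      have hrec : ∀ v : ℝ, (k : ℝ) ≤ v → v ≤ k + 1 →
          ∫ s in ((k : ℝ) - 1)..(v - 1), F j s / s = F (j + 1) v - F (j + 1) k :=
        fun v hv _ => integral_density_div_eq_sub hFc hFrec j hk2' hv
      set Cstep := C + C' * (3 + 8 * C₀) +
        4 * ((2 + 3 * (2 * (k + 1) * B' + 3 * B)) * C₀ * (B + 1) + 2 * B) + 4 * (1 + 5 * C₀)
        with hCstep
      have hCstep0 : 0 ≤ Cstep := by positivity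
      refine ⟨Cstep + (4 + 8 * B₂), by positivity, fun X Y hY hYX hXY => ?_⟩
      have hcast : ((j + 2 + (n + 1) : ℕ) : ℝ) = (k : ℝ) + 1 := by
        rw [hk_def]; push_cast; ring
      rw [hcast] at hXY
      have hX0 : 0 < X := by linarith
      have hly : 0 < Real.log Y := Real.log_pos (by linarith)
      have hU0 : 0 ≤ X / Real.log Y ^ 2 := by positivity
      have hweak : ∀ c : ℝ, c ≤ Cstep + (4 + 8 * B₂) → c * X / Real.log Y ^ 2 ≤
          (Cstep + (4 + 8 * B₂)) * X / Real.log Y ^ 2 := fun c hc => by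
        rw [mul_div_assoc, mul_div_assoc]
        exact mul_le_mul_of_nonneg_right hc hU0
      by_cases h1 : Real.log X ≤ k * Real.log Y
      · refine (hPk X Y hY hYX h1).trans (hweak C ?_)
        have : C ≤ Cstep := by
          rw [hCstep]
          have : 0 ≤ C' * (3 + 8 * C₀) +
            4 * ((2 + 3 * (2 * (k + 1) * B' + 3 * B)) * C₀ * (B + 1) + 2 * B) + 4 * (1 + 5 * C₀) := by
            positivity
          linarith
        linarith [this]
      push Not at h1
      rcases lt_or_ge Y (Real.exp 2) with h2 | h2
      · -- small `y`
        have hu1 : 1 ≤ Real.log X / Real.log Y := by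
          rw [le_div_iff₀ hly, one_mul]; exact Real.log_le_log (by linarith) hYX
        have hu2 : Real.log X / Real.log Y ≤ k + 1 := by rw [div_le_iff₀ hly]; exact hXY
        have hBu : |F (j + 1) (Real.log X / Real.log Y)| ≤ B₂ := hB₂ _ ⟨hu1, hu2⟩
        exact (abs_cell_sub_main_le_of_lt_exp_two hB₂0 hY hYX h2 hBu).trans (hweak _ (by linarith))
      · exact (abs_cell_sub_main_step hk2 hC hC' hC₀ hB hB' hE hPk hPk' hσc hσ hσ'c hσb hσ'b hrec h2
          hYX h1 hXY).trans (hweak _ (by linarith))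

end Literature.NumberTheory.Sieve

end
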